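import Mathlib
import HarnessLib
import Literature.Computability.AlgebraicComplexity.SymmetricArithCircuit
import Literature.Computability.AlgebraicComplexity.MonotoneStructure

/-!
# ValiantsHypothesis / MonotoneRestoration — `MonotoneRestorationQP`, line `Sketch`, stub H1

Support file for crux item `stmt-ValiantsHypothesis-15886`
(`Summit.ValiantsHypothesis.ValiantsHypothesis.Theses.MonotoneRestoration.MonotoneRestorationQP`),
line `Sketch`, stub `stub_gammaDescent` (descent to a degree-dropping multiplication gate, the
step of the monotone spine in Theorem γ).

In a labelled arithmetic circuit (`LabelledArithCircuit`, Dawar–Wilsenach Def. 2.2) over the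
semiring `ℝ≥0` nothing cancels: a summand of a `+` gate is supported inside the gate
(`coeff_le_coeff_sum`), and the support of a `×` gate is the Minkowski sum of the supports of
its children (`add_mem_support_mul`). Starting from a gate `g` whose nonzero polynomial is
homogeneous of degree `D ≥ k ≥ 2` and whose monomials extend, by every monomial of a context
polynomial `Q`, to monomials of `f`, we walk down the wires (well-founded induction along
`LabelledArithCircuit.wf`):

* input gates are impossible (`X x` is homogeneous of degree `1`, `C c` of degree `0`, and a
  nonzero polynomial has only one homogeneous degree, `IsHomogeneous.inj_right`);
* at a `+` gate some child carries a monomial of `g`, and its support lies inside that of `g`,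
  so the three properties pass to the child;
* at a `×` gate either every child has total degree `< D` (done), or some child `h` has total
  degree `≥ D`: a top monomial of `h` plus any monomial `m₂` of the (nonzero) cofactor is a
  monomial of `g`, of degree `D`, forcing `m₂ = 0`; hence the support of `h` lies inside that of
  `g` and the three properties pass to `h`.
-/

-- `Summit.ValiantsHypothesis.ValiantsHypothesis.…` is the tree's mandated single-conjunct layout
-- (Sub = Summit), so the duplicated namespace component is intended.
set_option linter.dupNamespace false

noncomputable section

namespace Summit.ValiantsHypothesis.ValiantsHypothesis.Theorems

open Literature.Computability.AlgebraicComplexity MvPolynomial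
open scoped NNReal

/-- A polynomial supported inside a homogeneous polynomial of degree `D` is homogeneous of
degree `D`. [folklore] -/
theorem gammaDescent_isHomogeneous_of_support_subset {σ R : Type*} [CommSemiring R]
    {p q : MvPolynomial σ R} {D : ℕ} (hq : q.IsHomogeneous D) (h : p.support ⊆ q.support) :
    p.IsHomogeneous D := by
  intro d hd
  exact hq (mem_support_iff.1 (h (mem_support_iff.2 hd)))

/-- Over `ℝ≥0` there is no cancellation: a summand of a finite sum is supported inside the sum.
[folklore] -/
theorem gammaDescent_support_subset_support_sum {ι κ : Type*} {α : Type*} (s : Finset α)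
    (T : α → MvPolynomial (ι × κ) ℝ≥0) {a : α} (ha : a ∈ s) :
    (T a).support ⊆ (∑ b ∈ s, T b).support := by
  intro m hm
  rw [mem_support_iff] at hm ⊢
  intro h0
  have hle := coeff_le_coeff_sum s T ha m
  rw [h0] at hle
  exact hm (le_antisymm hle zero_le)

/-- **H1 — descent to a degree-dropping multiplication gate (monotone spine step).** In a
labelled circuit over `ℝ≥0`, from a gate `g` whose nonzero polynomial is homogeneous of degree
`D ≥ k ≥ 2` and whose monomials extend (by every monomial of a context polynomial `Q`) into `f`,
one reaches — through `+` gates (a summand carrying a monomial of `g`; no cancellation,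
`coeff_le_coeff_sum`) and through `×` gates with a full-degree child (the cofactor then has the
constant monomial, `add_mem_support_mul`) — a `×` gate `P` with the same three properties all of
whose children have total degree `< D`; input gates are excluded since `D ≥ 2`. Well-founded
induction on the wires. [folklore] -/
theorem stub_gammaDescent {n : ℕ} {G : Type}
    (C : LabelledArithCircuit NNReal (Fin n × Fin n) Unit G)
    (f Q : MvPolynomial (Fin n × Fin n) NNReal) {D k : ℕ} (hk : 2 ≤ k) (hkD : k ≤ D)
    (g : G) (hg0 : C.eval g ≠ 0) (hhom : (C.eval g).IsHomogeneous D)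
    (hext : ∀ a ∈ Q.support, ∀ m ∈ (C.eval g).support, a + m ∈ f.support) :
    ∃ P : G, C.label P = .mul ∧ C.eval P ≠ 0 ∧ (C.eval P).IsHomogeneous D ∧
      (∀ a ∈ Q.support, ∀ m ∈ (C.eval P).support, a + m ∈ f.support) ∧
      ∀ c ∈ C.children P, (C.eval c).totalDegree < D := by
  classical
  induction g using C.wf.induction with
  | h g ih =>
    -- the three properties pass to a child supported inside `g`
    have transfer : ∀ h ∈ C.children g, (C.eval h).support ⊆ (C.eval g).support →
        C.eval h ≠ 0 →
        ∃ P : G, C.label P = .mul ∧ C.eval P ≠ 0 ∧ (C.eval P).IsHomogeneous D ∧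
          (∀ a ∈ Q.support, ∀ m ∈ (C.eval P).support, a + m ∈ f.support) ∧
          ∀ c ∈ C.children P, (C.eval c).totalDegree < D := by
      intro h hh hsub hh0
      exact ih h hh hh0 (gammaDescent_isHomogeneous_of_support_subset hhom hsub)
        (fun a ha m hm => hext a ha m (hsub hm))
    rcases hl : C.label g with x | c | _ | _
    · -- a variable gate has degree `1 < k ≤ D`
      exfalso
      have h1 : (C.eval g).IsHomogeneous 1 := by
        rw [C.eval_of_label_var hl]
        exact isHomogeneous_X _ _
      have h1D := h1.inj_right hhom hg0
      omega
    · -- a constant gate has degree `0 < k ≤ D`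
      exfalso
      have h0 : (C.eval g).IsHomogeneous 0 := by
        rw [C.eval_of_label_const hl]
        exact isHomogeneous_C _ _
      have h0D := h0.inj_right hhom hg0
      omega
    · -- addition gate: a child carrying a monomial of `g`
      obtain ⟨m₀, hm₀⟩ := support_nonempty.2 hg0
      rw [C.eval_of_label_add hl] at hm₀
      obtain ⟨h, hh, hmh⟩ := Finset.mem_biUnion.1 (support_sum hm₀)
      refine transfer h hh ?_ (support_nonempty.1 ⟨m₀, hmh⟩)
      rw [C.eval_of_label_add hl]
      exact gammaDescent_support_subset_support_sum (C.children g) (fun x => C.eval x) hh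
    · -- multiplication gate
      by_cases hall : ∀ c ∈ C.children g, (C.eval c).totalDegree < D
      · exact ⟨g, hl, hg0, hhom, hext, hall⟩
      · push Not at hall
        obtain ⟨h, hh, hDh⟩ := hall
        have hPR : C.eval g = C.eval h * ∏ x ∈ (C.children g).erase h, C.eval x := by
          rw [C.eval_of_label_mul hl, Finset.mul_prod_erase (C.children g) (fun x => C.eval x) hh]
        have hh0 : C.eval h ≠ 0 := by
          intro h0
          exact hg0 (by rw [hPR, h0, zero_mul])
        have hR0 : (∏ x ∈ (C.children g).erase h, C.eval x) ≠ 0 := by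
          intro h0
          exact hg0 (by rw [hPR, h0, mul_zero])
        -- a top-degree monomial `m₁` of `eval h` and any monomial `m₂` of the cofactor
        obtain ⟨m₁, hm₁, hdeg₁⟩ := Finset.exists_mem_eq_sup (C.eval h).support
          (support_nonempty.2 hh0) (fun s : (Fin n × Fin n) →₀ ℕ => s.sum fun _ e => e)
        obtain ⟨m₂, hm₂⟩ := support_nonempty.2 hR0
        have hm12 : m₁ + m₂ ∈ (C.eval g).support := by
          rw [hPR]
          exact add_mem_support_mul hm₁ hm₂
        have hdeg12 : Finsupp.degree m₁ + Finsupp.degree m₂ = D := by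
          rw [← map_add, Finsupp.degree_eq_weight_one]
          exact hhom (mem_support_iff.1 hm12)
        have hdeg1 : D ≤ Finsupp.degree m₁ := by
          calc D ≤ (C.eval h).totalDegree := hDh
            _ = m₁.sum (fun _ e => e) := hdeg₁
            _ = Finsupp.degree m₁ := rfl
        have hm₂0 : m₂ = 0 := (Finsupp.degree_eq_zero_iff m₂).1 (by omega)
        have hsub : (C.eval h).support ⊆ (C.eval g).support := by
          intro m hm
          have hm' := add_mem_support_mul hm hm₂
          rw [hm₂0, add_zero] at hm'
          rwa [hPR]
        exact transfer h hh hsub hh0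

end Summit.ValiantsHypothesis.ValiantsHypothesis.Theorems

end
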